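import Summits.NavierStokesRegularity.FunctionalMining.CodomainNPRpow
import HarnessLib

/-!
# FunctionalMining — top Lebesgue node at a real parameter, codomain-generic:
# `∫‖u‖^{6a+6} ≤ C (∫‖u‖^{2a}∑ₖ‖∂ₖu‖²)³` for zero-mean smooth `u : T³ → F`

Search for candidate a priori estimates; no regularity claim. Cell `pub-nsfunc`, prove seat
(gen 9). The codomain-generic twin of the top node `NonlinearPoincare.integral_norm_rpow_top_le`
of `VorticityMomentProduction` (typed there for fields `T^d → EuclideanSpace ℝ d`): for a smooth
zero-mean map `u : T^d → F` into a finite-dimensional real inner-product space and `a > 0`, the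
regularisation `W_ε = (‖u‖²+ε)^{a/2}u` (`CodomainNPRegularisation`), a mean-zero Sobolev constant
in coordinate form (`∫‖v‖⁶ ≤ C₆ (∫∑ₖ‖∂ₖv‖²)³`, on `T³` from
`CodomainSobolev.exists_integral_norm_pow_six_le_cube`), the mean control of `CodomainNPRpow` and
`ε → 0⁺` give `∫‖u‖^{6a+6} ≤ 32 (C₆ (1+a)⁶ + C_NP³) (∫‖u‖^{2a}∑ₖ‖∂ₖu‖²)³`. Needed for the top node
of tensor-valued moment ladders (strain moments, rows `ES.absS.q` of the 𝒦₀ matrix).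

## Main statements

* `integral_norm_rpow_top_le` — the top node given a coordinate-form Sobolev constant.
* `exists_integral_norm_rpow_top_le_three` — on `T³` (`#d = 3`) with the constant supplied.
-/

noncomputable section

open MeasureTheory Finset Set Filter
open scoped InnerProductSpace RealInnerProductSpace ContDiff Topology

namespace Summit.NavierStokesRegularity.FunctionalMining

open Literature.Analysis.FunctionSpaces Literature.Analysis.FunctionSpaces.Torus

namespace CodomainNP

variable {F : Type*} [NormedAddCommGroup F] [InnerProductSpace ℝ F] [FiniteDimensional ℝ F]

section Param

variable {d : Type*} [Fintype d]

/-- Continuity of `ε ↦ ∫_{T^d} G(ε, x) dx` for jointly continuous `G` (compact torus). [folklore] -/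
private theorem continuous_integral_param'' {E' : Type*} [NormedAddCommGroup E'] [NormedSpace ℝ E']
    {G : ℝ → UnitAddTorus d → E'} (hG : Continuous (Function.uncurry G)) :
    Continuous fun ε => ∫ x, G ε x := by
  have h := continuous_parametric_integral_of_continuous (μ := volume) hG isCompact_univ
  simpa only [Measure.restrict_univ] using h

/-- Passing to `ε → 0⁺` in `V ≤ φ ε` (`0 < ε ≤ 1`) with `φ` continuous at `0`. [folklore] -/
private theorem le_of_forall_pos_le_of_continuousAt'' {V : ℝ} {φ : ℝ → ℝ} (hφ : ContinuousAt φ 0)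
    (h : ∀ ε : ℝ, 0 < ε → ε ≤ 1 → V ≤ φ ε) : V ≤ φ 0 := by
  have ht : Tendsto φ (𝓝[>] 0) (𝓝 (φ 0)) := hφ.tendsto.mono_left nhdsWithin_le_nhds
  refine ge_of_tendsto ht ?_
  have hmem : Ioo (0 : ℝ) 1 ∈ 𝓝[>] (0 : ℝ) := Ioo_mem_nhdsGT one_pos
  filter_upwards [hmem] with ε hε using h ε hε.1 hε.2.le

end Param


variable {d : Type*} [Fintype d] [DecidableEq d]

omit [Fintype d] [DecidableEq d] in
/-- `(a + b)⁶ ≤ 32 (a⁶ + b⁶)`. [folklore] -/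
private theorem add_pow_six_le (a b : ℝ) : (a + b) ^ 6 ≤ 32 * (a ^ 6 + b ^ 6) := by
  have h1 : (a + b) ^ 2 ≤ 2 * (a ^ 2 + b ^ 2) := by nlinarith [sq_nonneg (a - b)]
  have h2 : ∀ {p q : ℝ}, 0 ≤ p → 0 ≤ q → (p + q) ^ 3 ≤ 4 * (p ^ 3 + q ^ 3) := by
    intro p q hp hq; nlinarith [sq_nonneg (p - q), mul_nonneg hp hq]
  calc (a + b) ^ 6 = ((a + b) ^ 2) ^ 3 := by ring
    _ ≤ (2 * (a ^ 2 + b ^ 2)) ^ 3 := pow_le_pow_left₀ (by positivity) h1 3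
    _ = 8 * (a ^ 2 + b ^ 2) ^ 3 := by ring
    _ ≤ 8 * (4 * ((a ^ 2) ^ 3 + (b ^ 2) ^ 3)) :=
        mul_le_mul_of_nonneg_left (h2 (sq_nonneg a) (sq_nonneg b)) (by norm_num)
    _ = 32 * (a ^ 6 + b ^ 6) := by ring

/-- **Top node at a real parameter `a > 0`.** Given a mean-zero Sobolev constant `C₆`
(`∫‖v‖⁶ ≤ C₆ ‖∇v‖₂⁶`; on `T³` from `CodomainSobolev.exists_integral_norm_pow_six_le_cube`), for
every smooth zero-mean `u` on `T^d`:
`∫‖u‖^{6a+6} ≤ 32 (C₆ (1+a)⁶ + C_NP³) (∫‖u‖^{2a}∑ₖ‖∂ₖu‖²)³`, `C_NP = 6(1 + (3^{1+a})²)(1+a)² d³`.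
[ours] -/
theorem integral_norm_rpow_top_le {C₆ : ℝ} (hC₆0 : 0 ≤ C₆)
    (hC₆ : ∀ v : UnitAddTorus d → F, IsSmooth v → HasZeroMean v →
      ∫ x, ‖v x‖ ^ 6 ≤ C₆ * (∫ x, ∑ k, ‖partialDeriv k v x‖ ^ 2) ^ 3)
    {u : UnitAddTorus d → F} (hu : IsSmooth u) (h0 : HasZeroMean u)
    {a : ℝ} (ha : 0 < a) :
    ∫ x, ‖u x‖ ^ (6 * a + 6) ≤
      32 * (C₆ * (1 + a) ^ 6 +
          (6 * (1 + ((3 : ℝ) ^ (1 + a)) ^ 2) * (1 + a) ^ 2 * (Fintype.card d : ℝ) ^ 3) ^ 3) *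
        (∫ x, ‖u x‖ ^ (2 * a) * ∑ k, ‖partialDeriv k u x‖ ^ 2) ^ 3 := by
  obtain ⟨I, hI⟩ : ∃ I : ℝ, I = ∫ x, ‖u x‖ ^ (2 * a) * ∑ k, ‖partialDeriv k u x‖ ^ 2 := ⟨_, rfl⟩
  obtain ⟨CNP, hCNP⟩ : ∃ C : ℝ,
      C = 6 * (1 + ((3 : ℝ) ^ (1 + a)) ^ 2) * (1 + a) ^ 2 * (Fintype.card d : ℝ) ^ 3 := ⟨_, rfl⟩
  rw [← hI, ← hCNP]
  have huc : Continuous u := hu.continuous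
  have hcs : Continuous fun x => ∑ k, ‖partialDeriv k u x‖ ^ 2 :=
    continuous_finsetSum _ fun k _ => (hu.partialDeriv k).continuous.norm.pow 2
  have hcs0 : ∀ x, 0 ≤ ∑ k, ‖partialDeriv k u x‖ ^ 2 := fun x =>
    Finset.sum_nonneg fun k _ => sq_nonneg _
  have hI0 : 0 ≤ I := by
    rw [hI]; exact integral_nonneg fun x => mul_nonneg (Real.rpow_nonneg (norm_nonneg _) _) (hcs0 x)
  have hCNP0 : 0 ≤ CNP := by rw [hCNP]; positivity
  -- the two parametric integrals
  set J : ℝ → ℝ := fun ε => ∫ x, (‖u x‖ ^ 2 + ε) ^ a * ∑ k, ‖partialDeriv k u x‖ ^ 2 with hJ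
  set L : ℝ → ℝ := fun ε => ∫ x, (‖u x‖ ^ 2 + ε) ^ a * ‖u x‖ ^ 2 with hL
  have hNP : L 0 ≤ CNP * I := by
    have h := integral_norm_rpow_le_weighted hu h0 ha
    rw [← hI, ← hCNP] at h
    have e : L 0 = ∫ x, ‖u x‖ ^ (2 * a + 2) := by
      simp only [hL, add_zero]
      refine integral_congr_ae (ae_of_all _ fun x => ?_)
      show (‖u x‖ ^ 2) ^ a * ‖u x‖ ^ 2 = ‖u x‖ ^ (2 * a + 2)
      have hn : 0 ≤ ‖u x‖ := norm_nonneg _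
      have e1 : (‖u x‖ ^ 2) ^ a = ‖u x‖ ^ (2 * a) := by
        rw [← Real.rpow_natCast, ← Real.rpow_mul hn]; norm_num
      rw [e1]
      rcases eq_or_lt_of_le hn with hz | hpos
      · rw [← hz, Real.zero_rpow (by linarith), Real.zero_rpow (by linarith)]; simp
      · rw [← Real.rpow_natCast ‖u x‖ 2, ← Real.rpow_add hpos]; norm_num
    rw [e]; exact h
  have hJ0 : J 0 = I := by
    simp only [hJ, hI, add_zero]
    refine integral_congr_ae (ae_of_all _ fun x => ?_)
    have : (‖u x‖ ^ 2) ^ a = ‖u x‖ ^ (2 * a) := by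
      rw [← Real.rpow_natCast, ← Real.rpow_mul (norm_nonneg _)]; norm_num
    simp only [this]
  have hL00 : 0 ≤ L 0 := by
    simp only [hL]
    exact integral_nonneg fun x => mul_nonneg (Real.rpow_nonneg (by positivity) _) (sq_nonneg _)
  -- for every `0 < ε ≤ 1`
  have hε : ∀ ε : ℝ, 0 < ε → ε ≤ 1 →
      ∫ x, ‖u x‖ ^ (6 * a + 6) ≤ 32 * (C₆ * ((1 + a) ^ 2 * J ε) ^ 3 + L ε ^ 3) := by
    intro ε hε _
    set Wε : UnitAddTorus d → F := fun x => (‖u x‖ ^ 2 + ε) ^ (a / 2) • u x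
      with hWε
    set cε : F := ∫ x, Wε x with hcε
    have hWεs : IsSmooth Wε := isSmooth_regA hu hε (a / 2)
    have hWεc : Continuous Wε := hWεs.continuous
    have hpos : ∀ x, 0 < ‖u x‖ ^ 2 + ε := fun x => by positivity
    -- `‖Wε x‖² = (‖u‖²+ε)^a ‖u‖²`
    have hnormsq : ∀ x, ‖Wε x‖ ^ 2 = (‖u x‖ ^ 2 + ε) ^ a * ‖u x‖ ^ 2 := by
      intro x
      simp only [hWε]
      rw [norm_smul, Real.norm_of_nonneg (Real.rpow_nonneg (hpos x).le _), mul_pow,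
        ← Real.rpow_natCast ((‖u x‖ ^ 2 + ε) ^ (a / 2)), ← Real.rpow_mul (hpos x).le]
      norm_num
    -- Sobolev for `Wε − cε`
    have hsm : IsSmooth (fun x => Wε x - cε) := hWεs.sub (isSmooth_const cε)
    have hzm : HasZeroMean (fun x => Wε x - cε) := by
      show ∫ x, (Wε x - cε) = 0
      rw [integral_sub hWεc.integrable_unitAddTorus (integrable_const _), integral_const, hcε]
      simp
    have hS := hC₆ _ hsm hzm
    have hg : ∫ x, ∑ k, ‖partialDeriv k (fun x => Wε x - cε) x‖ ^ 2 =
        ∫ x, ∑ k, ‖partialDeriv k Wε x‖ ^ 2 := by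
      refine integral_congr_ae (ae_of_all _ fun x => ?_)
      refine Finset.sum_congr rfl fun k _ => ?_
      have e : (fun x => Wε x - cε) = Wε + fun _ => -cε := by
        funext y; simp [sub_eq_add_neg]
      have hcst : IsContDiff 1 (fun _ : UnitAddTorus d => -cε) := contDiff_const
      have hz : partialDeriv k (fun _ : UnitAddTorus d => -cε) x = 0 := by
        simp [Torus.partialDeriv, Torus.lineDeriv]
      rw [e, partialDeriv_add (hWεs.isContDiff (by simp)) hcst, Pi.add_apply, hz, add_zero]
    have hG : ∫ x, ∑ k, ‖partialDeriv k Wε x‖ ^ 2 ≤ (1 + a) ^ 2 * J ε :=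
      dirichlet_regA_le hu ha.le hε
    have hG0 : 0 ≤ ∫ x, ∑ k, ‖partialDeriv k Wε x‖ ^ 2 :=
      integral_nonneg fun x => Finset.sum_nonneg fun k _ => sq_nonneg _
    have hS' : ∫ x, ‖Wε x - cε‖ ^ 6 ≤ C₆ * ((1 + a) ^ 2 * J ε) ^ 3 := by
      calc ∫ x, ‖Wε x - cε‖ ^ 6
          ≤ C₆ * (∫ x, ∑ k, ‖partialDeriv k (fun x => Wε x - cε) x‖ ^ 2) ^ 3 := hS
        _ = C₆ * (∫ x, ∑ k, ‖partialDeriv k Wε x‖ ^ 2) ^ 3 := by rw [hg]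
        _ ≤ C₆ * ((1 + a) ^ 2 * J ε) ^ 3 := by gcongr
    -- the mean: `‖cε‖⁶ ≤ (L ε)³`
    have hLε : ∫ x, ‖Wε x‖ ^ 2 = L ε := by
      simp only [hL]; exact integral_congr_ae (ae_of_all _ hnormsq)
    have hLε0 : 0 ≤ L ε := by rw [← hLε]; exact integral_nonneg fun x => sq_nonneg _
    have hc6 : ‖cε‖ ^ 6 ≤ L ε ^ 3 := by
      have h1 : ‖cε‖ ≤ ∫ x, ‖Wε x‖ := norm_integral_le_integral_norm _
      have h2 : ∫ x, ‖Wε x‖ ≤ Real.sqrt (∫ x, ‖Wε x‖ ^ 2) :=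
        VelocityL4.integral_le_sqrt_integral_sq hWεc.norm
      rw [hLε] at h2
      calc ‖cε‖ ^ 6 ≤ Real.sqrt (L ε) ^ 6 := pow_le_pow_left₀ (norm_nonneg _) (h1.trans h2) 6
        _ = (Real.sqrt (L ε) ^ 2) ^ 3 := by ring
        _ = L ε ^ 3 := by rw [Real.sq_sqrt hLε0]
    -- pointwise `‖u‖^{6a+6} ≤ ‖Wε‖⁶ ≤ 32(‖Wε − cε‖⁶ + ‖cε‖⁶)`
    have hpt : ∀ x, ‖u x‖ ^ (6 * a + 6) ≤ 32 * (‖Wε x - cε‖ ^ 6 + ‖cε‖ ^ 6) := by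
      intro x
      have hn : 0 ≤ ‖u x‖ := norm_nonneg _
      have hW1 : ‖u x‖ ^ (a + 1) ≤ ‖Wε x‖ := by
        simp only [hWε]
        rw [norm_smul, Real.norm_of_nonneg (Real.rpow_nonneg (hpos x).le _)]
        have e1 : (‖u x‖ ^ 2) ^ (a / 2) = ‖u x‖ ^ a := by
          rw [← Real.rpow_natCast, ← Real.rpow_mul hn]
          congr 1
          push_cast
          ring
        have hmono : ‖u x‖ ^ a ≤ (‖u x‖ ^ 2 + ε) ^ (a / 2) := by
          rw [← e1]; exact Real.rpow_le_rpow (sq_nonneg _) (by linarith) (by positivity)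
        rcases eq_or_lt_of_le hn with hz | hp
        · rw [← hz, Real.zero_rpow (by linarith)]; simp
        · calc ‖u x‖ ^ (a + 1) = ‖u x‖ ^ a * ‖u x‖ := by rw [Real.rpow_add hp, Real.rpow_one]
            _ ≤ (‖u x‖ ^ 2 + ε) ^ (a / 2) * ‖u x‖ := mul_le_mul_of_nonneg_right hmono hn
      have e6 : ‖u x‖ ^ (6 * a + 6) = (‖u x‖ ^ (a + 1)) ^ 6 := by
        rw [← Real.rpow_natCast (‖u x‖ ^ (a + 1)), ← Real.rpow_mul hn]
        congr 1
        push_cast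
        ring
      have h6 : (‖u x‖ ^ (a + 1)) ^ 6 ≤ ‖Wε x‖ ^ 6 :=
        pow_le_pow_left₀ (Real.rpow_nonneg hn _) hW1 6
      have hsplit : ‖Wε x‖ ^ 6 ≤ 32 * (‖Wε x - cε‖ ^ 6 + ‖cε‖ ^ 6) := by
        have h := norm_add_le (Wε x - cε) cε
        rw [sub_add_cancel] at h
        exact (pow_le_pow_left₀ (norm_nonneg _) h 6).trans (add_pow_six_le _ _)
      rw [e6]; exact h6.trans hsplit
    have hi1 : Integrable (fun x => ‖Wε x - cε‖ ^ 6) volume :=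
      ((hWεc.sub continuous_const).norm.pow 6).integrable_unitAddTorus
    have hi2 : Integrable (fun _ : UnitAddTorus d => ‖cε‖ ^ 6) volume := integrable_const _
    have hcu : Continuous fun x => ‖u x‖ ^ (6 * a + 6) :=
      huc.norm.rpow_const fun _ => Or.inr (by positivity)
    calc ∫ x, ‖u x‖ ^ (6 * a + 6) ≤ ∫ x, 32 * (‖Wε x - cε‖ ^ 6 + ‖cε‖ ^ 6) :=
          integral_mono hcu.integrable_unitAddTorus ((hi1.add hi2).const_mul 32) hpt
      _ = 32 * ((∫ x, ‖Wε x - cε‖ ^ 6) + ‖cε‖ ^ 6) := by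
          rw [integral_const_mul, integral_add hi1 hi2, integral_const]; simp
      _ ≤ 32 * (C₆ * ((1 + a) ^ 2 * J ε) ^ 3 + L ε ^ 3) := by
          gcongr
  -- `ε → 0⁺`
  have hJc : Continuous J := by
    refine continuous_integral_param'' ?_
    have h1 : Continuous fun p : ℝ × UnitAddTorus d => (‖u p.2‖ ^ 2 + p.1) ^ a :=
      (((huc.comp continuous_snd).norm.pow 2).add continuous_fst).rpow_const fun _ => Or.inr ha.le
    exact h1.mul (hcs.comp continuous_snd)
  have hLc : Continuous L := by
    refine continuous_integral_param'' ?_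
    have h1 : Continuous fun p : ℝ × UnitAddTorus d => (‖u p.2‖ ^ 2 + p.1) ^ a :=
      (((huc.comp continuous_snd).norm.pow 2).add continuous_fst).rpow_const fun _ => Or.inr ha.le
    exact h1.mul ((huc.comp continuous_snd).norm.pow 2)
  have hφc : ContinuousAt (fun ε : ℝ => 32 * (C₆ * ((1 + a) ^ 2 * J ε) ^ 3 + L ε ^ 3)) 0 :=
    ((((hJc.continuousAt.const_mul _).pow 3).const_mul C₆).add (hLc.continuousAt.pow 3)).const_mul 32
  have hmain := le_of_forall_pos_le_of_continuousAt'' hφc hε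
  rw [hJ0] at hmain
  have hL3 : L 0 ^ 3 ≤ (CNP * I) ^ 3 := pow_le_pow_left₀ hL00 hNP 3
  calc ∫ x, ‖u x‖ ^ (6 * a + 6) ≤ 32 * (C₆ * ((1 + a) ^ 2 * I) ^ 3 + L 0 ^ 3) := hmain
    _ ≤ 32 * (C₆ * ((1 + a) ^ 2 * I) ^ 3 + (CNP * I) ^ 3) := by gcongr
    _ = 32 * (C₆ * (1 + a) ^ 6 + CNP ^ 3) * I ^ 3 := by ring


/-- **Top node on `T³`, codomain-generic**: for `#d = 3` there is `C ≥ 0` (depending on `a > 0`)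
with `∫‖u‖^{6a+6} ≤ C (∫‖u‖^{2a}∑ₖ‖∂ₖu‖²)³` for every smooth zero-mean `u : T³ → F`. [ours] -/
theorem exists_integral_norm_rpow_top_le_three (hd : Fintype.card d = 3) {a : ℝ} (ha : 0 < a) :
    ∃ C : ℝ, 0 ≤ C ∧ ∀ u : UnitAddTorus d → F, IsSmooth u → HasZeroMean u →
      ∫ x, ‖u x‖ ^ (6 * a + 6) ≤
        C * (∫ x, ‖u x‖ ^ (2 * a) * ∑ k, ‖partialDeriv k u x‖ ^ 2) ^ 3 := by
  obtain ⟨C₆, hC₆0, hC₆⟩ := CodomainSobolev.exists_integral_norm_pow_six_le_cube (F := F) hd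
  exact ⟨_, by positivity, fun u hu h0 => integral_norm_rpow_top_le hC₆0 hC₆ hu h0 ha⟩

end CodomainNP

end Summit.NavierStokesRegularity.FunctionalMining
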